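import Literature.NumberTheory.GaloisCohomology.PoitouTate
import HarnessLib

/-!
# A `μₙ`-valued pairing `M₁ × M₂ → μₙ` as a map `M₂ → M₁^D`, and its Poitou–Tate local terms

Topic `NumberTheory/GaloisCohomology`; namespace `Literature.NumberTheory.GaloisRepresentations`
(dot-notation extensions of `DiscreteGaloisModule`). Definitions with bodies and theorems only: **no
named fact is introduced** (D-0026).

The tree's local Tate pairing and Poitou–Tate local terms (`LocalInvariants.localTerm`,
`.SumLocalTermEqZero`, file `PoitouTate`) pair `H¹(K, M)` with `H¹(K, M^D)`, `M^D = Hom(M, μₙ)`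
(`tateDual`), through the evaluation pairing (`tateDualPairing`). A general `Γ_K`-equivariant
bi-additive pairing `B : M₁ × M₂ → μₙ` (packaged by the tree's `DiscreteGaloisModule.pairing`) is the
evaluation pairing after the dual map `B^♭ : M₂ → M₁^D`, `y ↦ B(·, y)`:

* `pairingDualHom n B : M₂ →+ TateDual K M₁ n`, `Γ_K`-equivariant (`pairingDualHom_smul`), packaged
  as `pairingDualIntertwining hB : M₂ →ⁱ M₁^D`;
* **`x ∪_B y = x ∪_{ev} (B^♭)_* y`** (`cupProduct_pairing_eq_tateDualPairing`, by
  `ContPairing.cupProduct_adjoint`);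
* over a number field: the local term of `(x, (B^♭)_* y)` is `inv_v (loc_v (x ∪_B y))`
  (`localTerm_pairingDual`) and the Poitou–Tate vanishing of a family `inv` gives
  `∑_{v ∈ S} inv_v (loc_v (x ∪_B y)) = 0` for `M₁` killed by `n`
  (`sum_inv_localization_cupProduct_pairing_eq_zero`).

This generalises `WeilPairingTateDual.lean` (the Weil pairing on `E[n] × E[n]`) and serves the
descended / mixed pairings `E[d] × E[d] → μ_{kd}`, `E[d] × E[kd] → μ_{kd}` of
`WeilPairingLevelDescent.lean` in the single-level construction of the Cassels–Tate pairing
(provefact `WeierstrassCurve.exists_casselsTate_pairing`; Milne, *ADT*, I, proof of Prop. 6.9 with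
Thm. 4.10(b)).

## References

* [MilneADT2006] J. S. Milne, *Arithmetic Duality Theorems*, 2nd ed. (2006), Ch. I §2 (`M^D`),
  Thm. 4.10(b), §6 proof of Prop. 6.9.
* [NeukirchSchmidtWingberg2008] J. Neukirch, A. Schmidt, K. Wingberg, *Cohomology of Number Fields*
  (2008), I §4 (1.4.2).
-/

noncomputable section

open scoped Classical

universe u

namespace Literature.NumberTheory.GaloisRepresentations

open CategoryTheory Field
open DiscreteGaloisModule (mu MuCarrier pairing TateDual tateDual tateDualPairing tateDualEval)
open scoped ContRepresentation

-- Cup products need `LocallyCompactSpace Γ_K`; the compactness of absolute Galois groups is a local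
-- instance only (as in `LocalTatePairing.lean`).
attribute [local instance] absoluteGaloisGroup_compactSpace

section General

variable {K : Type u} [Field K]
variable {M₁ : Type u} [AddCommGroup M₁] [TopologicalSpace M₁] [DiscreteTopology M₁] [Finite M₁]
variable {M₂ : Type u} [AddCommGroup M₂] [TopologicalSpace M₂] [DiscreteTopology M₂]
variable (ρ₁ : DiscreteGaloisModule K M₁) (ρ₂ : DiscreteGaloisModule K M₂) (n : ℕ)
variable (B : M₁ →+ M₂ →+ MuCarrier K n)

/-- **The dual map of a pairing**: `M₂ → M₁^D = Hom(M₁, μₙ)`, `y ↦ (x ↦ B x y)`. [folklore] -/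
def DiscreteGaloisModule.pairingDualHom : M₂ →+ TateDual K M₁ n :=
  AddMonoidHom.mk' (fun y => B.flip y) fun y y' => map_add B.flip y y'

omit [TopologicalSpace M₁] [DiscreteTopology M₁] [Finite M₁] [TopologicalSpace M₂] [DiscreteTopology M₂] in
/-- Unfolding `pairingDualHom`. [folklore] -/
@[simp]
theorem DiscreteGaloisModule.pairingDualHom_apply_apply (y : M₂) (x : M₁) :
    DiscreteGaloisModule.pairingDualHom n B y x = B x y :=
  rfl

variable {ρ₁ ρ₂ n B}
variable (hB : ∀ (σ : absoluteGaloisGroup K) (x : M₁) (y : M₂), B (ρ₁ σ x) (ρ₂ σ y) = mu K n σ (B x y))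
include hB

/-- **The dual map of an equivariant pairing is equivariant** for the Tate-dual action
`(σ f)(x) = σ f(σ⁻¹ x)`. [folklore] -/
theorem DiscreteGaloisModule.pairingDualHom_smul (σ : absoluteGaloisGroup K) (y : M₂) :
    DiscreteGaloisModule.pairingDualHom n B (ρ₂ σ y) =
      ρ₁.tateDual n σ (DiscreteGaloisModule.pairingDualHom n B y) := by
  refine TateDual.ext fun x => ?_
  rw [DiscreteGaloisModule.tateDual_apply_apply_apply, DiscreteGaloisModule.pairingDualHom_apply_apply,
    DiscreteGaloisModule.pairingDualHom_apply_apply, ← hB σ (ρ₁ σ⁻¹ x) y, ← Module.End.mul_apply,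
    ← _root_.map_mul ρ₁, mul_inv_cancel, _root_.map_one, Module.End.one_apply]

/-- **The dual map of an equivariant pairing as a morphism of discrete Galois modules**
`M₂ → M₁^D`. [folklore] -/
def DiscreteGaloisModule.pairingDualIntertwining :
    ρ₂.toContRepresentation →ⁱL (ρ₁.tateDual n).toContRepresentation where
  toContinuousLinearMap :=
    ⟨(DiscreteGaloisModule.pairingDualHom n B).toIntLinearMap, continuous_of_discreteTopology⟩
  isIntertwining' σ := ContinuousLinearMap.ext fun y =>
    DiscreteGaloisModule.pairingDualHom_smul hB σ y

/-- Unfolding `pairingDualIntertwining`. [folklore] -/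
@[simp]
theorem DiscreteGaloisModule.pairingDualIntertwining_apply (y : M₂) :
    DiscreteGaloisModule.pairingDualIntertwining hB y = DiscreteGaloisModule.pairingDualHom n B y :=
  rfl

/-- **The cup product of a `μₙ`-valued equivariant pairing is the evaluation cup product after the
dual map**: `x ∪_B y = x ∪_{ev} (B^♭)_* y` in `H²(K, μₙ)` for `x ∈ H¹(K, M₁)`, `y ∈ H¹(K, M₂)`
(adjoint naturality of the cup product, tree `ContPairing.cupProduct_adjoint`). The tree's
`cupProduct_weilContPairing_eq` (`WeilPairingTateDual.lean`) is the case of the Weil pairing on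
`E[n] × E[n]`. [folklore] -/
theorem DiscreteGaloisModule.cupProduct_pairing_eq_tateDualPairing (x : galoisCohomology ρ₁ 1)
    (y : galoisCohomology ρ₂ 1) :
    (pairing ρ₁ ρ₂ (mu K n) B hB).cupProduct x y =
      (tateDualPairing ρ₁ n).cupProduct x
        (galoisCohomology.map (DiscreteGaloisModule.pairingDualIntertwining hB) 1 y) := by
  have h := ContPairing.cupProduct_adjoint (tateDualPairing ρ₁ n) (pairing ρ₁ ρ₂ (mu K n) B hB) (𝟙 _)
    (TopRep.ofHom ⟨(DiscreteGaloisModule.pairingDualIntertwining hB).toContinuousLinearMap,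
      (DiscreteGaloisModule.pairingDualIntertwining hB).isIntertwining'⟩)
    (fun _ _ => rfl) x y
  have h1 : (cohomologyMap (𝟙 ρ₁.toTopRep) 1) x = x := by
    rw [show cohomologyMap (𝟙 ρ₁.toTopRep) 1 = 𝟙 _ from map_id_eq_id _ (fun _ => rfl) 1]
    rfl
  rw [h1] at h
  exact h

end General

/-! ### Over a number field: Poitou–Tate local terms of a `μₙ`-valued pairing -/

section NumberField

open NumberField
open Literature.NumberTheory.GaloisCohomology

variable {K : Type u} [Field K] [NumberField K]
variable {M₁ : Type u} [AddCommGroup M₁] [TopologicalSpace M₁] [DiscreteTopology M₁] [Finite M₁]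
variable {M₂ : Type u} [AddCommGroup M₂] [TopologicalSpace M₂] [DiscreteTopology M₂]
variable {ρ₁ : DiscreteGaloisModule K M₁} {ρ₂ : DiscreteGaloisModule K M₂} {n : ℕ}
variable {B : M₁ →+ M₂ →+ MuCarrier K n}
variable (hB : ∀ (σ : absoluteGaloisGroup K) (x : M₁) (y : M₂), B (ρ₁ σ x) (ρ₂ σ y) = mu K n σ (B x y))
include hB

/-- **The Poitou–Tate local term of the pair `(x, (B^♭)_* y)` is `inv_v` of the localised cup product
`x ∪_B y`**: `⟨x_v, ((B^♭)_* y)_v⟩_v = inv_v (loc_v (x ∪_B y))`. [folklore] -/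
theorem DiscreteGaloisModule.localTerm_pairingDual (inv : LocalInvariants K n) (v : Place K)
    (x : galoisCohomology ρ₁ 1) (y : galoisCohomology ρ₂ 1) :
    inv.localTerm ρ₁ v x (galoisCohomology.map (DiscreteGaloisModule.pairingDualIntertwining hB) 1 y) =
      inv v (galoisCohomology.localization (mu K n) v 2 ((pairing ρ₁ ρ₂ (mu K n) B hB).cupProduct x y)) := by
  rw [LocalInvariants.localTerm_eq_apply_localization_cupProduct,
    DiscreteGaloisModule.cupProduct_pairing_eq_tateDualPairing]

/-- **Poitou–Tate for a `μₙ`-valued pairing.** If the family `inv` satisfies the Poitou–Tate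
vanishing (`LocalInvariants.SumLocalTermEqZero`, the content of the named fact
`poitouTate_sum_localTatePairing_eq_zero`) and `M₁` is killed by `n`, then for global
`x ∈ H¹(K, M₁)`, `y ∈ H¹(K, M₂)` and every finite set of places `S` outside which the terms vanish,
`∑_{v ∈ S} inv_v (loc_v (x ∪_B y)) = 0`. [cite: MilneADT2006, Ch. I, Thm. 4.10(b)] -/
theorem DiscreteGaloisModule.sum_inv_localization_cupProduct_pairing_eq_zero (inv : LocalInvariants K n)
    (hPT : inv.SumLocalTermEqZero) (hM₁ : ∀ m : M₁, n • m = 0)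
    (x : galoisCohomology ρ₁ 1) (y : galoisCohomology ρ₂ 1) (S : Finset (Place K))
    (hS : ∀ v ∉ S, inv v (galoisCohomology.localization (mu K n) v 2
      ((pairing ρ₁ ρ₂ (mu K n) B hB).cupProduct x y)) = 0) :
    ∑ v ∈ S, inv v (galoisCohomology.localization (mu K n) v 2
      ((pairing ρ₁ ρ₂ (mu K n) B hB).cupProduct x y)) = 0 := by
  have h := hPT ρ₁ hM₁ x (galoisCohomology.map (DiscreteGaloisModule.pairingDualIntertwining hB) 1 y) S
    (fun v hv => by
      rw [DiscreteGaloisModule.localTerm_pairingDual]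
      exact hS v hv)
  simpa only [DiscreteGaloisModule.localTerm_pairingDual] using h

end NumberField

end Literature.NumberTheory.GaloisRepresentations
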